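import Summits.Ventures.HodgeRepro2.T6A1HypHost
import Summits.Ventures.HodgeRepro2.T6A1HostBetti
import Summits.Ventures.HodgeRepro2.T6A2HypLef

/-!
# T6A1HostBridge — the A1 displays consumed BY NAME into the binder shapes of the A1 host side (README §10.3
«every displayed hypothesis is consumed by name»; owner t6-p1)

`T6A1HostBetti` states its host-side theorems over BINDER SHAPES (`Lemma1117Q`, the `hspan` equation) so that
the lead's composite (`T6ShadowHost`) can be written before the display file lands. This file is the explicit
bridge from the cited displays of `T6A1HypHost` (v3, p412358) to those binders, so that the final theorem can
bind `(h17 : Hyp.LangeBirkenhake1992_Lemma1_1_17)` and `(h21 : Hyp.LangeBirkenhake1992_Thm1_1_21_Betti Bd)`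
BY NAME and the displays appear in its used-constants cone. No new display, no new definition, no axiom.
VERSION 2 (append-only over p413386): + `lefschetz11Shape_of_display` (t6-p2's display `Hyp.Lefschetz11_Betti Bd`,
T6A2HypLef, IS the binder shape `A1HostBetti.Lefschetz11Shape Bd` of `hLef_of_lefschetz11`) and
`clauseB_of_clauses` (clause (b) of the lead's `Host.BettiClauses coeffC Bd` IS `A1HostBetti.ClauseB Bd`) —
the two remaining binder shapes of the A1 host side discharged from the named display / the named clauses
(t6-ref-1's row-232 watch). The version-1 declarations are byte-identical.
§8(d): uses an L-value-free non-vanishing device: NO.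
-/

noncomputable section

open scoped TensorProduct
open HostAPI.Carriers.AlgebraicGeometry.Motives HostAPI.Carriers.AlgebraicGeometry.HodgeTheory

namespace Summit.Ventures.HodgeRepro2.T6.A1HostBridge

open Host A1HostBetti

/-- The display `Hyp.LangeBirkenhake1992_Lemma1_1_17` (Lange–Birkenhake Lemma 1.1.17 on the rational Betti
cohomology, `T6A1HypHost`) IS the binder `A1HostBetti.Lemma1117Q` of `factorDataHC` / `factorIdentHC` /
`hostIdentW` / `splitWeilAlgebraic_of_periodN` (definitional: the two `Prop`s are written identically). -/
theorem lemma1117Q_of_display (h : Hyp.LangeBirkenhake1992_Lemma1_1_17) : Lemma1117Q := h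

/-- The converse, so that the two spellings are interchangeable in every binder position. -/
theorem display_of_lemma1117Q (h : Lemma1117Q) : Hyp.LangeBirkenhake1992_Lemma1_1_17 := h

section corner

variable {K : Type} [Field K] [NumberField K] [NumberField.IsCMField K] (Bd : BettiHodgeData ℂ)
  (C : CornerProduct K)

/-- The display `Hyp.LangeBirkenhake1992_Thm1_1_21_Betti Bd` (the `(1,1)`-clause of Lange–Birkenhake
Thm 1.1.21, `Bd`-parametrised) at the corner product `B` is exactly the hypothesis of
`A1HostBetti.span11_le_of_eq`. -/
theorem hodgeHC_two_eq_span_of_display (h : Hyp.LangeBirkenhake1992_Thm1_1_21_Betti Bd) :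
    hodgeHC Bd C.smooth 2 1 1 = Submodule.span ℂ {w | ∃ v : Fin 2 → HC C.B.X 1,
      v 0 ∈ hodgeHC Bd C.smooth 1 1 0 ∧ v 1 ∈ hodgeHC Bd C.smooth 1 0 1 ∧ w = cupC11 C.B.X (v 0) (v 1)} :=
  h C.B C.smooth

/-- The display gives the `hspan` binder of `A1HostBetti.alg_lefschetz_HC` at the corner product. -/
theorem span11_le_of_display (h : Hyp.LangeBirkenhake1992_Thm1_1_21_Betti Bd) :
    A1DictHodge2.span11 (fun a b => cupC11 C.B.X a b) (hodgeHC Bd C.smooth 1 1 0)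
      (hodgeHC Bd C.smooth 1 0 1) ≤ hodgeHC Bd C.smooth 2 1 1 :=
  span11_le_of_eq Bd C (hodgeHC_two_eq_span_of_display Bd C h)

end corner

section lefschetz

variable (Bd : BettiHodgeData ℂ)

/-- t6-p2's display `Hyp.Lefschetz11_Betti Bd` (Lefschetz (1,1) in the `Bd`-vocabulary, `T6A2HypLef`) IS the
binder `A1HostBetti.Lefschetz11Shape Bd` of `hLef_of_lefschetz11` (the degree `2 * 1` of the display and the
degree `2` of the binder are the same numeral). -/
theorem lefschetz11Shape_of_display (h : Hyp.Lefschetz11_Betti Bd) : Lefschetz11Shape Bd :=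
  fun _ _ hX => h hX

/-- Clause (b) of the lead's `Host.BettiClauses coeffC Bd` (`BettiClausesAlg Bd`: the algebraic classes of
`Bd.W` are the host's coniveau classes along `isoObj`) IS the binder `A1HostBetti.ClauseB Bd` of
`hLef_of_lefschetz11`. -/
theorem clauseB_of_clauses (coeffC : ∀ (X : SchemeOver ℂ) (k : ℕ), HC X k →ₗ[ℂ] H X k)
    (hB : BettiClauses coeffC Bd) : ClauseB Bd :=
  hB.2.1

/-- The `hLef` binder of `A1HostBetti.alg_lefschetz_HC` at a corner product, from the NAMED display and the
NAMED clauses: a rational class of `ℂ ⊗ H²(B, ℚ)` in the transported `(1,1)`-piece has coniveau `≥ 1`. -/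
theorem hLef_of_display {K : Type} [Field K] [NumberField K] [NumberField.IsCMField K] (C : CornerProduct K)
    (coeffC : ∀ (X : SchemeOver ℂ) (k : ℕ), HC X k →ₗ[ℂ] H X k) (hB : BettiClauses coeffC Bd)
    (hL : Hyp.Lefschetz11_Betti Bd) :
    ∀ c : HC C.B.X 2, c ∈ (A1BaseChange.ratC : Submodule ℚ (HC C.B.X 2)) → c ∈ hodgeHC Bd C.smooth 2 1 1 →
      c ∈ (coniveau C.B.X 2 1).baseChange ℂ :=
  hLef_of_lefschetz11 Bd C (lefschetz11Shape_of_display Bd hL) (clauseB_of_clauses Bd coeffC hB)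

end lefschetz

end Summit.Ventures.HodgeRepro2.T6.A1HostBridge

end
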